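import Summits.RiemannHypothesis.RiemannHypothesis.Theses.IntegerScrew
import Literature.NumberTheory.LFunctions.ZetaScrewThm42Proofs
import Mathlib.NumberTheory.Harmonic.Bounds
import HarnessLib

/-!
# Route IntegerScrew — `ScrewUpperSlack` (item stmt-RiemannHypothesis-15764)

BARELY PSD, QUANTIFIED (RH-free): `∃ C M₀, ∀ M ≥ M₀, ∃ x ≠ 0, x·S_M·x ≤ C (log M)³/M · Σ x²`.

Proof (the prime-free wall, much cheaper than the Montgomery–Vaughan plan of the route text):
test the two-point vector `x = 𝟙_M − 𝟙_{M−1}`.  Bilinearity and `G(t,t) = 2Ψ(t)`,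
`G(t,u) = Ψ(t) + Ψ(u) − Ψ(t−u)` give `x·S_M·x = 2Ψ(v)` with `v = log M − log(M−1) ∈ [1/M, 1/(M−1)]`,
while `Σ x² = 2`.  On the wall `|v| < log 2` the screw function is prime-free
(`Suzuki2023Thm42.zetaScrew_eq_cosh_tsum`):
`Ψ(v) = 8(cosh(v/2) − 1) − (A/2)v + Σ_k (1 − e^{−λ_k v})/λ_k²`, `λ_k = 2k + 1/2`, `A > 0`, and for
`0 < v ≤ 1/2` we show `Ψ(v) ≤ 4v(1 + log(1/v))` (split the series at `K = ⌊1/v⌋ + 1`: head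
`≤ 2v + (v/2)·H_{K−1} ≤ 2v + (v/2)(1 + log(1/v))` by `1 − e^{−x} ≤ x` and the harmonic bound, tail
`≤ Σ_{k ≥ K} 1/(4k²) ≤ 1/(2K) ≤ v/2`; `8(cosh(v/2) − 1) ≤ v`).  Hence for `M ≥ 4`,
`x·S_M·x = 2Ψ(v) ≤ 8·(2/M)(1 + log M) ≤ 16·(log M)³/M·Σx²`, i.e. `C = 16`, `M₀ = 4`
(so `λ_min(S_M) ≲ (log M)/M`: the margin of the route's matrices is at most polynomially small).
-/

-- `Summit.RiemannHypothesis.RiemannHypothesis.…` duplicates `RiemannHypothesis` BY DESIGN (D-0017).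
set_option linter.dupNamespace false

noncomputable section

namespace Summit.RiemannHypothesis.RiemannHypothesis.Theorems

open Literature.NumberTheory.LFunctions
open scoped BigOperators
open Finset

namespace IntegerScrew

/-- `8(cosh(v/2) − 1) ≤ v` for `0 ≤ v ≤ 1/2` (from `cosh x ≤ e^{x²/2}` and `e^y − 1 ≤ 2y`, `|y| ≤ 1`). -/
theorem eight_mul_cosh_half_sub_one_le {v : ℝ} (hv0 : 0 ≤ v) (hv : v ≤ 1 / 2) :
    8 * (Real.cosh (v / 2) - 1) ≤ v := by
  have h1 : Real.cosh (v / 2) ≤ Real.exp ((v / 2) ^ 2 / 2) := Real.cosh_le_exp_half_sq _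
  have hy0 : 0 ≤ (v / 2) ^ 2 / 2 := by positivity
  have hy1 : |(v / 2) ^ 2 / 2| ≤ 1 := by
    rw [abs_of_nonneg hy0]
    nlinarith
  have h2 := Real.abs_exp_sub_one_le hy1
  rw [abs_of_nonneg hy0] at h2
  have h3 := (abs_le.1 h2).2
  nlinarith

/-- **Small-`v` upper bound for the screw function on the prime-free wall**:
for `0 < v ≤ 1/2`, `Ψ(v) ≤ 4 v (1 + log(1/v))`. -/
theorem zetaScrew_le_of_le_half {v : ℝ} (hv0 : 0 < v) (hv : v ≤ 1 / 2) :
    zetaScrew v ≤ 4 * v * (1 + Real.log (1 / v)) := by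
  have hlog2 := Real.log_two_gt_d9
  have hvlt : |v| < Real.log 2 := by
    rw [abs_of_pos hv0]
    linarith
  rw [Suzuki2023Thm42.zetaScrew_eq_cosh_tsum hvlt, abs_of_pos hv0]
  have hlogv : 0 ≤ Real.log (1 / v) := Real.log_nonneg (by rw [le_div_iff₀ hv0]; linarith)
  -- (i) the `cosh` term
  have hcosh := eight_mul_cosh_half_sub_one_le hv0.le hv
  -- (ii) the linear term is `≤ 0`
  have hA : 0 ≤ (Real.eulerMascheroniConstant + Real.pi / 2 + 3 * Real.log 2 + Real.log Real.pi)
      / 2 * v := by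
    have hγ : 0 < Real.eulerMascheroniConstant := by
      have := Real.one_half_lt_eulerMascheroniConstant
      linarith
    have hπ : 0 < Real.log Real.pi := Real.log_pos (by have := Real.pi_gt_three; linarith)
    have hl2 : 0 < Real.log 2 := by linarith
    positivity
  -- (iii) the series
  set f : ℕ → ℝ := fun k =>
    (1 - Real.exp (-((2 * k + 1 / 2) * v))) / (2 * (k : ℝ) + 1 / 2) ^ 2 with hf
  have hf0 : ∀ k, 0 ≤ f k := fun k => by
    apply div_nonneg _ (by positivity)
    rw [sub_nonneg, Real.exp_le_one_iff, neg_nonpos]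
    positivity
  have hfs : Summable f := by
    have h := Suzuki2023Thm42.summable_mul_one_sub_exp_div 1 v
    simp only [one_mul, abs_of_pos hv0] at h
    exact h
  -- termwise bounds
  have hf_head : ∀ k : ℕ, f k ≤ v / (2 * (k : ℝ) + 1 / 2) := by
    intro k
    have hlam : 0 < 2 * (k : ℝ) + 1 / 2 := by positivity
    rw [hf]
    dsimp only
    rw [div_le_div_iff₀ (by positivity) hlam]
    have h1 : 1 - Real.exp (-((2 * k + 1 / 2) * v)) ≤ (2 * k + 1 / 2) * v := by
      have := Real.add_one_le_exp (-((2 * (k : ℝ) + 1 / 2) * v))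
      linarith
    have h2 : 0 ≤ 1 - Real.exp (-((2 * k + 1 / 2) * v)) := by
      rw [sub_nonneg, Real.exp_le_one_iff, neg_nonpos]; positivity
    nlinarith
  have hf_tail : ∀ k : ℕ, 1 ≤ k → f k ≤ (1 / 4) * ((k : ℝ) ^ 2)⁻¹ := by
    intro k hk
    have hk' : (1 : ℝ) ≤ k := by exact_mod_cast hk
    have h1 : f k ≤ 1 / (2 * (k : ℝ) + 1 / 2) ^ 2 := by
      rw [hf]
      apply div_le_div_of_nonneg_right _ (by positivity)
      linarith [Real.exp_pos (-((2 * k + 1 / 2) * v))]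
    have h2 : 1 / (2 * (k : ℝ) + 1 / 2) ^ 2 ≤ (1 / 4) * ((k : ℝ) ^ 2)⁻¹ := by
      rw [show (1 / 4 : ℝ) * ((k : ℝ) ^ 2)⁻¹ = 1 / (4 * (k : ℝ) ^ 2) by ring]
      apply one_div_le_one_div_of_le (by positivity)
      nlinarith
    exact le_trans h1 h2
  -- the splitting point
  set K : ℕ := ⌊1 / v⌋₊ + 1 with hK
  have hK1 : 1 ≤ K := by omega
  have hKv : 1 / v < K := by
    rw [hK]
    push_cast
    exact Nat.lt_floor_add_one _
  have hKle : ((K - 1 : ℕ) : ℝ) ≤ 1 / v := by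
    rw [hK, Nat.add_sub_cancel]
    exact Nat.floor_le (by positivity)
  have hKpos : (0 : ℝ) < K := by exact_mod_cast (show 0 < K by omega)
  have hinvK : 1 / (K : ℝ) ≤ v := by
    rw [div_le_iff₀ hKpos]
    rw [div_lt_iff₀ hv0] at hKv
    linarith
  -- head: `Σ_{k < K} f k ≤ 2v + (v/2)(1 + log(1/v))`
  have hhead : ∑ k ∈ range K, f k ≤ 2 * v + v / 2 * (1 + Real.log (1 / v)) := by
    obtain ⟨K', hK'⟩ : ∃ K', K = K' + 1 := ⟨K - 1, by omega⟩
    rw [hK', Finset.sum_range_succ']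
    have h0 : f 0 ≤ 2 * v := by
      have := hf_head 0
      simp only [Nat.cast_zero, mul_zero, zero_add] at this
      linarith [show v / (1 / 2 : ℝ) = 2 * v by ring]
    have h1 : ∑ k ∈ range K', f (k + 1) ≤ v / 2 * ∑ k ∈ range K', ((k : ℝ) + 1)⁻¹ := by
      rw [Finset.mul_sum]
      refine Finset.sum_le_sum fun k _ => ?_
      have h := hf_head (k + 1)
      push_cast at h
      have hk1 : (0 : ℝ) < (k : ℝ) + 1 := by positivity
      calc f (k + 1) ≤ v / (2 * ((k : ℝ) + 1) + 1 / 2) := h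
        _ ≤ v / (2 * ((k : ℝ) + 1)) := by
            apply div_le_div_of_nonneg_left hv0.le (by positivity); linarith
        _ = v / 2 * ((k : ℝ) + 1)⁻¹ := by rw [div_mul_eq_div_div, div_eq_mul_inv (v / 2)]
    have hharm : ∑ k ∈ range K', ((k : ℝ) + 1)⁻¹ ≤ 1 + Real.log (1 / v) := by
      have hh : ∑ k ∈ range K', ((k : ℝ) + 1)⁻¹ = ((harmonic K' : ℚ) : ℝ) := by
        simp [harmonic]
      rw [hh]
      refine le_trans (harmonic_le_one_add_log K') ?_
      have hK'le : (K' : ℝ) ≤ 1 / v := by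
        have : (K - 1 : ℕ) = K' := by omega
        rw [← this]; exact hKle
      rcases Nat.eq_zero_or_pos K' with h0' | hpos
      · subst h0'
        simp only [Nat.cast_zero, Real.log_zero, add_zero]
        linarith
      · have hK'pos : (0 : ℝ) < K' := by exact_mod_cast hpos
        linarith [Real.log_le_log hK'pos hK'le]
    have hv2 : 0 ≤ v / 2 := by positivity
    calc ∑ k ∈ range K', f (k + 1) + f 0
        ≤ v / 2 * ∑ k ∈ range K', ((k : ℝ) + 1)⁻¹ + 2 * v := add_le_add h1 h0
      _ ≤ v / 2 * (1 + Real.log (1 / v)) + 2 * v :=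
          add_le_add (mul_le_mul_of_nonneg_left hharm hv2) le_rfl
      _ = 2 * v + v / 2 * (1 + Real.log (1 / v)) := by ring
  -- tail: `Σ' k, f (k + K) ≤ v/2`
  have htail : ∑' k, f (k + K) ≤ v / 2 := by
    refine Real.tsum_le_of_sum_range_le (fun k => hf0 _) fun n => ?_
    have step1 : ∑ i ∈ range n, f (i + K) ≤ ∑ i ∈ range n, (1 / 4) * (((i + K : ℕ) : ℝ) ^ 2)⁻¹ :=
      Finset.sum_le_sum fun i _ => hf_tail (i + K) (by omega)
    have step2 : ∑ i ∈ range n, (1 / 4) * (((i + K : ℕ) : ℝ) ^ 2)⁻¹ =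
        (1 / 4) * ∑ j ∈ Ico K (K + n), ((j : ℝ) ^ 2)⁻¹ := by
      rw [Finset.mul_sum, Finset.sum_Ico_eq_sum_range, Nat.add_sub_cancel_left]
      refine Finset.sum_congr rfl fun i _ => ?_
      rw [add_comm i K]
    have step3 : ∑ j ∈ Ico K (K + n), ((j : ℝ) ^ 2)⁻¹ ≤ ∑ j ∈ Ioo (K - 1) (K + n), ((j : ℝ) ^ 2)⁻¹ := by
      apply Finset.sum_le_sum_of_subset_of_nonneg
      · intro j hj
        simp only [Finset.mem_Ico] at hj
        simp only [Finset.mem_Ioo]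
        omega
      · intro j _ _; positivity
    have step4 : ∑ j ∈ Ioo (K - 1) (K + n), ((j : ℝ) ^ 2)⁻¹ ≤ 2 / ((K - 1 : ℕ) + 1) :=
      sum_Ioo_inv_sq_le (K - 1) (K + n)
    have hcast : (((K - 1 : ℕ) : ℝ) + 1) = K := by
      rw [Nat.cast_sub hK1]; push_cast; ring
    rw [hcast] at step4
    calc ∑ i ∈ range n, f (i + K) ≤ (1 / 4) * ∑ j ∈ Ico K (K + n), ((j : ℝ) ^ 2)⁻¹ := by
          rw [← step2]; exact step1
      _ ≤ (1 / 4) * (2 / K) := by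
          apply mul_le_mul_of_nonneg_left (le_trans step3 step4) (by norm_num)
      _ = (1 / 2) * (1 / K) := by ring
      _ ≤ (1 / 2) * v := mul_le_mul_of_nonneg_left hinvK (by norm_num)
      _ = v / 2 := by ring
  have hseries : ∑' k, f k ≤ 2 * v + v / 2 * (1 + Real.log (1 / v)) + v / 2 := by
    rw [← hfs.sum_add_tsum_nat_add K]
    exact add_le_add hhead htail
  -- assemble
  have hvlog : 0 ≤ v * Real.log (1 / v) := mul_nonneg hv0.le hlogv
  calc 8 * (Real.cosh (v / 2) - 1)
        - (Real.eulerMascheroniConstant + Real.pi / 2 + 3 * Real.log 2 + Real.log Real.pi) / 2 * v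
        + ∑' k, f k
      ≤ v - 0 + (2 * v + v / 2 * (1 + Real.log (1 / v)) + v / 2) := by
        refine add_le_add (sub_le_sub hcosh hA) hseries
    _ ≤ 4 * v * (1 + Real.log (1 / v)) := by nlinarith

/-- The two-point quadratic form: for `a ≠ b` in `s` and the vector `x = 𝟙_a − 𝟙_b`,
`Σ_{m,m' ∈ s} K(m,m') x_m x_m' = K(a,a) − K(a,b) − K(b,a) + K(b,b)`. -/
theorem sum_sum_two_point {s : Finset ℕ} {a b : ℕ} (ha : a ∈ s) (hb : b ∈ s) (hab : a ≠ b)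
    (Kf : ℕ → ℕ → ℝ) :
    ∑ m ∈ s, ∑ m' ∈ s, Kf m m' *
        ((if m = a then (1 : ℝ) else if m = b then -1 else 0) *
          (if m' = a then (1 : ℝ) else if m' = b then -1 else 0)) =
      Kf a a - Kf a b - Kf b a + Kf b b := by
  classical
  -- inner sums
  have inner : ∀ m ∈ s, ∑ m' ∈ s, Kf m m' *
      ((if m = a then (1 : ℝ) else if m = b then -1 else 0) *
        (if m' = a then (1 : ℝ) else if m' = b then -1 else 0)) =
      (if m = a then (1 : ℝ) else if m = b then -1 else 0) * (Kf m a - Kf m b) := by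
    intro m _
    have e : ∀ m', Kf m m' *
        ((if m = a then (1 : ℝ) else if m = b then -1 else 0) *
          (if m' = a then (1 : ℝ) else if m' = b then -1 else 0)) =
        (if m = a then (1 : ℝ) else if m = b then -1 else 0) *
          ((if m' = a then Kf m m' else 0) + (if m' = b then -Kf m m' else 0)) := by
      intro m'
      by_cases h1 : m' = a
      · have h2 : ¬ m' = b := fun h => hab (h1.symm.trans h)
        simp only [if_pos h1, if_neg h2]
        ring
      · by_cases h2 : m' = b
        · simp only [if_neg h1, if_pos h2]
          ring
        · simp only [if_neg h1, if_neg h2]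
          ring
    simp_rw [e]
    rw [← Finset.mul_sum, Finset.sum_add_distrib, Finset.sum_ite_eq' s a, Finset.sum_ite_eq' s b,
      if_pos ha, if_pos hb]
    ring
  rw [Finset.sum_congr rfl inner]
  have e2 : ∀ m, (if m = a then (1 : ℝ) else if m = b then -1 else 0) * (Kf m a - Kf m b) =
      (if m = a then Kf m a - Kf m b else 0) + (if m = b then -(Kf m a - Kf m b) else 0) := by
    intro m
    by_cases h1 : m = a
    · have h2 : ¬ m = b := fun h => hab (h1.symm.trans h)
      simp only [if_pos h1, if_neg h2]
      ring
    · by_cases h2 : m = b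
      · simp only [if_neg h1, if_pos h2]
        ring
      · simp only [if_neg h1, if_neg h2]
        ring
  simp_rw [e2]
  rw [Finset.sum_add_distrib, Finset.sum_ite_eq' s a, Finset.sum_ite_eq' s b, if_pos ha, if_pos hb]
  ring

end IntegerScrew

open IntegerScrew in
/-- **`ScrewUpperSlack`** (route IntegerScrew, item stmt-RiemannHypothesis-15764), unconditionally,
with `C = 16`, `M₀ = 4` and the witness `x = 𝟙_M − 𝟙_{M−1}`:
`x·S_M·x = 2Ψ(log(M/(M−1))) ≤ 16 (log M)³/M · Σ x²`. -/
theorem screwUpperSlack_proof :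
    Summit.RiemannHypothesis.RiemannHypothesis.Theses.IntegerScrew.ScrewUpperSlack := by
  classical
  refine ⟨16, 4, fun M hM => ?_⟩
  -- the witness
  refine ⟨fun m => if m = M then (1 : ℝ) else if m = M - 1 then -1 else 0, ?_, ?_⟩
  · -- `0 < Σ x²` : the term `m = M` contributes `1`
    have hmem : M ∈ Icc 2 M := Finset.mem_Icc.mpr ⟨by omega, le_rfl⟩
    have h1 : (1 : ℝ) ≤ ∑ m ∈ Icc 2 M,
        (if m = M then (1 : ℝ) else if m = M - 1 then -1 else 0) ^ 2 := by
      rw [← Finset.add_sum_erase _ _ hmem]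
      simp only [if_true]
      have : 0 ≤ ∑ m ∈ (Icc 2 M).erase M,
          (if m = M then (1 : ℝ) else if m = M - 1 then -1 else 0) ^ 2 :=
        Finset.sum_nonneg fun m _ => sq_nonneg _
      linarith
    linarith
  · -- the quadratic form equals `2 Ψ(v)`
    have hM1 : M - 1 ∈ Icc 2 M := Finset.mem_Icc.mpr ⟨by omega, by omega⟩
    have hMM : M ∈ Icc 2 M := Finset.mem_Icc.mpr ⟨by omega, le_rfl⟩
    have hne : M ≠ M - 1 := by omega
    rw [sum_sum_two_point hMM hM1 hne (fun m m' => zetaScrewKernel (Real.log m) (Real.log m'))]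
    simp only
    rw [zetaScrewKernel_self, zetaScrewKernel_self, zetaScrewKernel_comm (Real.log ↑(M - 1)),
      zetaScrewKernel_def]
    -- now: 2Ψ(a) - 2(Ψ(a) + Ψ(b) - Ψ(a - b)) + 2Ψ(b) = 2Ψ(a-b)
    set v : ℝ := Real.log (M : ℝ) - Real.log ((M - 1 : ℕ) : ℝ) with hv
    have hMr : (4 : ℝ) ≤ M := by exact_mod_cast hM
    have hM1r : ((M - 1 : ℕ) : ℝ) = (M : ℝ) - 1 := by
      rw [Nat.cast_sub (by omega)]; simp
    have hMpos : (0 : ℝ) < M := by linarith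
    have hM1pos : (0 : ℝ) < (M : ℝ) - 1 := by linarith
    -- `1/M ≤ v ≤ 1/(M-1) ≤ 1/2`
    have hv_eq : v = Real.log ((M : ℝ) / ((M : ℝ) - 1)) := by
      rw [hv, hM1r, Real.log_div hMpos.ne' hM1pos.ne']
    have hv_lo : 1 / (M : ℝ) ≤ v := by
      rw [hv_eq]
      have h := Real.one_sub_inv_le_log_of_pos (div_pos hMpos hM1pos)
      rw [inv_div] at h
      have e : 1 - ((M : ℝ) - 1) / M = 1 / M := by field_simp; ring
      linarith
    have hv_hi : v ≤ 1 / ((M : ℝ) - 1) := by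
      rw [hv_eq]
      have h := Real.log_le_sub_one_of_pos (div_pos hMpos hM1pos)
      have e : (M : ℝ) / ((M : ℝ) - 1) - 1 = 1 / ((M : ℝ) - 1) := by field_simp; ring
      linarith
    have hv0 : 0 < v := lt_of_lt_of_le (by positivity) hv_lo
    have hvhalf : v ≤ 1 / 2 := by
      refine le_trans hv_hi ?_
      rw [div_le_iff₀ hM1pos]; linarith
    have hΨ := zetaScrew_le_of_le_half hv0 hvhalf
    -- `log(1/v) ≤ log M`, `v ≤ 2/M`
    have hlogv : Real.log (1 / v) ≤ Real.log M := by
      apply Real.log_le_log (by positivity)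
      rw [div_le_iff₀ hv0]
      rw [div_le_iff₀ hMpos] at hv_lo
      linarith
    have hv2M : v ≤ 2 / M := by
      refine le_trans hv_hi ?_
      rw [div_le_div_iff₀ hM1pos hMpos]; linarith
    have hlogM : 1 ≤ Real.log M := by
      rw [← Real.log_exp 1]
      apply Real.log_le_log (Real.exp_pos 1)
      have := Real.exp_one_lt_d9
      linarith
    -- the sum of squares is `2`
    have hsq : ∑ m ∈ Icc 2 M,
        (if m = M then (1 : ℝ) else if m = M - 1 then -1 else 0) ^ 2 = 2 := by
      have e : ∀ m, (if m = M then (1 : ℝ) else if m = M - 1 then -1 else 0) ^ 2 =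
          (if m = M then (1 : ℝ) else 0) + (if m = M - 1 then 1 else 0) := by
        intro m
        by_cases h1 : m = M
        · have h2 : ¬ m = M - 1 := fun h => hne (h1.symm.trans h)
          simp only [if_pos h1, if_neg h2]
          norm_num
        · by_cases h2 : m = M - 1
          · simp only [if_neg h1, if_pos h2]
            norm_num
          · simp only [if_neg h1, if_neg h2]
            norm_num
      simp_rw [e]
      rw [Finset.sum_add_distrib, Finset.sum_ite_eq' (Icc 2 M) M, Finset.sum_ite_eq' (Icc 2 M) (M - 1),
        if_pos hMM, if_pos hM1]
      norm_num
    rw [hsq]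
    have hform : 2 * zetaScrew (Real.log M) -
        (zetaScrew (Real.log M) + zetaScrew (Real.log ↑(M - 1)) -
          zetaScrew (Real.log M - Real.log ↑(M - 1))) -
        (zetaScrew (Real.log M) + zetaScrew (Real.log ↑(M - 1)) -
          zetaScrew (Real.log M - Real.log ↑(M - 1))) +
        2 * zetaScrew (Real.log ↑(M - 1)) = 2 * zetaScrew v := by
      rw [hv]; ring
    rw [hform]
    -- `2 Ψ(v) ≤ 8 v (1 + log(1/v)) ≤ 8 (2/M) (2 log M) ≤ 16 (log M)^3 / M * 2`
    have h1 : 2 * zetaScrew v ≤ 8 * v * (1 + Real.log (1 / v)) := by linarith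
    have h2 : 8 * v * (1 + Real.log (1 / v)) ≤ 8 * (2 / M) * (2 * Real.log M) := by
      have ha : 1 + Real.log (1 / v) ≤ 2 * Real.log M := by linarith
      have hb : 0 ≤ 1 + Real.log (1 / v) := by
        have : 0 ≤ Real.log (1 / v) := Real.log_nonneg (by rw [le_div_iff₀ hv0]; linarith)
        linarith
      calc 8 * v * (1 + Real.log (1 / v)) ≤ 8 * (2 / M) * (1 + Real.log (1 / v)) :=
            mul_le_mul_of_nonneg_right (by linarith) hb
        _ ≤ 8 * (2 / M) * (2 * Real.log M) :=
            mul_le_mul_of_nonneg_left ha (by positivity)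
    have h3 : 8 * (2 / (M : ℝ)) * (2 * Real.log M) ≤ 16 * Real.log M ^ 3 / M * 2 := by
      rw [show 8 * (2 / (M : ℝ)) * (2 * Real.log M) = (32 * Real.log M) / M by ring,
        show 16 * Real.log M ^ 3 / M * 2 = (32 * Real.log M ^ 3) / M by ring]
      apply div_le_div_of_nonneg_right _ hMpos.le
      have : Real.log M ≤ Real.log M ^ 3 := by
        calc Real.log M = Real.log M * 1 * 1 := by ring
          _ ≤ Real.log M * Real.log M * Real.log M := by
              apply mul_le_mul (mul_le_mul_of_nonneg_left hlogM (by linarith)) hlogM zero_le_one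
              positivity
          _ = Real.log M ^ 3 := by ring
      linarith
    linarith

end Summit.RiemannHypothesis.RiemannHypothesis.Theorems

end
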